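import Literature.Analysis.InverseSpectral.KreinString
import HarnessLib

/-!
# Lower step approximation of a monotone-density Kreĭn string, part 1: step data and measures

Helper file (part 1 of 2) for the stub `stub_stepApprox` of the line `Sketch` (card
`telegraph-string`) of the crux
`Summit.RiemannHypothesis.RiemannHypothesis.Theses.LeeYang.LeeyangThesis`
(item stmt-RiemannHypothesis-0451).

* (`stub_stepApprox_grid`, registered sub-goal of the stub) For `ρ` non-decreasing on `(-∞, L)`
  and zero on `(-∞, 0)` and `0 ≤ x < L`: on the uniform grid `t_i = i η`, `η = x / M`, the lower
  step function `g = Σ_{i<M} (ρ(t_i) - ρ(t_{i-1})) 𝟙[t_i ≤ ·]` (`ρ(t_{-1}) = ρ(-η) = 0`) equals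
  `ρ(t_k)` on
  `[t_k, t_{k+1})`, so `g ≤ ρ` on `(-∞, x]` and `ρ - g ≤ ρ(t_{k+1}) - ρ(t_k)` there; hence
  `∫_{(-∞,x]} (ρ - g) ≤ η (ρ(x) - ρ(0)) ≤ δ` for `M` large. Zero increments are dropped
  (`stepApprox_filter`) so that all increments are positive and the breakpoints strictly increase.
* (`stepApprox_decomp`, `stepApprox_mass_sub`) If a string `S` has density `ρ` on `(-∞, L)` and a
  string `T` has density `g`, `0 ≤ g ≤ ρ` on `(-∞, x]`, then
  `μ_S|(-∞,x] = μ_T|(-∞,x] + (ρ - g) dy|(-∞,x]`, whence domination of the masses on `(-∞, x]` and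
  `|m_T(v) - m_S(v)| ≤ ∫_{(-∞,x]} (ρ - g)` for `v ≤ x`.
-/

noncomputable section

-- single-problem summit namespace `Summit.RiemannHypothesis.RiemannHypothesis.…` (D-0017)
set_option linter.dupNamespace false

open MeasureTheory Filter Topology Set
open scoped ENNReal
open Literature.Analysis.InverseSpectral

namespace Summit.RiemannHypothesis.RiemannHypothesis.Theorems.LeeYangTelegraphString

/-! ### Step data: dropping zero increments -/

/-- Dropping the zero increments of step data: for strictly increasing breakpoints `t_i` and
increments `c_i ≥ 0` (`i < M`), the sub-family of positive increments, re-indexed increasingly by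
`Fin N`, defines the same step function `Σ c_i 𝟙[t_i ≤ ·]`. -/
theorem stepApprox_filter (M : ℕ) (t c : ℕ → ℝ) (hc : ∀ i < M, 0 ≤ c i) :
    ∃ (N : ℕ) (e : Fin N → ℕ), StrictMono e ∧ (∀ j, e j < M) ∧ (∀ j, 0 < c (e j)) ∧
      ∀ y : ℝ, ∑ j : Fin N, (Set.Ici (t (e j))).indicator (fun _ => c (e j)) y =
        ∑ i ∈ Finset.range M, (Set.Ici (t i)).indicator (fun _ => c i) y := by
  classical
  obtain ⟨F, hF⟩ : ∃ F : Finset ℕ, F = (Finset.range M).filter (fun i => 0 < c i) := ⟨_, rfl⟩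
  refine ⟨F.card, fun j => F.orderEmbOfFin rfl j, (F.orderEmbOfFin rfl).strictMono, ?_, ?_, ?_⟩
  · intro j
    have h : F.orderEmbOfFin rfl j ∈ (Finset.range M).filter (fun i => 0 < c i) := by
      rw [← hF]; exact F.orderEmbOfFin_mem rfl j
    rw [Finset.mem_filter, Finset.mem_range] at h
    exact h.1
  · intro j
    have h : F.orderEmbOfFin rfl j ∈ (Finset.range M).filter (fun i => 0 < c i) := by
      rw [← hF]; exact F.orderEmbOfFin_mem rfl j
    rw [Finset.mem_filter] at h
    exact h.2
  · intro y
    have h1 : ∑ j : Fin F.card, (Set.Ici (t (F.orderEmbOfFin rfl j))).indicator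
        (fun _ => c (F.orderEmbOfFin rfl j)) y =
        ∑ i ∈ F, (Set.Ici (t i)).indicator (fun _ => c i) y := by
      conv_rhs => rw [← Finset.map_orderEmbOfFin_univ F rfl]
      rw [Finset.sum_map]
      rfl
    rw [h1, hF]
    refine Finset.sum_filter_of_ne (fun i hi hne => ?_)
    refine lt_of_le_of_ne (hc i (Finset.mem_range.1 hi)) (fun h0 => hne ?_)
    rw [← h0]
    simp

/-! ### Lower step functions of a monotone density on a uniform grid -/

/-- **Lower step approximation in `L¹`.** For `ρ` non-decreasing on `(-∞, L)` and zero on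
`(-∞, 0)`, `0 ≤ x < L` and `δ > 0`, there are step data `0 ≤ s₀ < … < s_{N-1} ≤ x`, `d_j > 0` with
`g = Σ_j d_j 𝟙[s_j ≤ ·] ≤ ρ` on `(-∞, x]` and `∫_{(-∞, x]} (ρ - g) ≤ δ` (uniform grid, lower
Darboux-type step function of a monotone function). -/
theorem stub_stepApprox_grid : ∀ (ρ : ℝ → ℝ) (L x δ : ℝ), MonotoneOn ρ (Set.Iio L) →
    (∀ y < 0, ρ y = 0) → 0 ≤ x → x < L → 0 < δ →
    ∃ (N : ℕ) (s d : Fin N → ℝ), StrictMono s ∧ (∀ j, 0 ≤ s j) ∧ (∀ j, s j ≤ x) ∧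
      (∀ j, 0 < d j) ∧
      (∀ y ≤ x, ∑ j, (Set.Ici (s j)).indicator (fun _ => d j) y ≤ ρ y) ∧
      ∫⁻ y in Set.Iic x, ENNReal.ofReal (ρ y - ∑ j, (Set.Ici (s j)).indicator (fun _ => d j) y)
        ≤ ENNReal.ofReal δ := by
  intro ρ L x δ hmono hρ0 hx0 hxL hδ
  -- `ρ ≥ 0` on `(-∞, L)`
  have hρnn : ∀ y < L, 0 ≤ ρ y := by
    intro y hy
    rcases lt_or_ge y 0 with h | h
    · exact (hρ0 y h).ge
    · have hL0 : (0 : ℝ) < L := h.trans_lt hy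
      have h1 : ρ (-1) ≤ ρ y := hmono (show (-1 : ℝ) < L by linarith) hy (by linarith)
      rwa [hρ0 (-1) (by norm_num)] at h1
  rcases hx0.eq_or_lt with hx | hx
  · -- `x = 0`: no steps at all
    subst hx
    refine ⟨0, Fin.elim0, Fin.elim0, fun i => Fin.elim0 i, fun i => Fin.elim0 i,
      fun i => Fin.elim0 i, fun i => Fin.elim0 i, ?_, ?_⟩
    · intro y hy
      simp [hρnn y (hy.trans_lt hxL)]
    · calc ∫⁻ y in Set.Iic (0 : ℝ), ENNReal.ofReal
              (ρ y - ∑ j : Fin 0, (Set.Ici (Fin.elim0 j : ℝ)).indicator (fun _ => Fin.elim0 j) y)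
          = ∫⁻ y in Set.Iio (0 : ℝ), ENNReal.ofReal
              (ρ y - ∑ j : Fin 0, (Set.Ici (Fin.elim0 j : ℝ)).indicator
                (fun _ => Fin.elim0 j) y) :=
            setLIntegral_congr Iio_ae_eq_Iic.symm
        _ = 0 := setLIntegral_eq_zero measurableSet_Iio (fun y hy => by simp [hρ0 y hy])
        _ ≤ _ := zero_le
  · -- `x > 0`: uniform grid of mesh `η = x / M`
    have hB0 : 0 ≤ ρ x := hρnn x hxL
    obtain ⟨M, hM1, hMδ⟩ : ∃ M : ℕ, 1 ≤ M ∧ x * ρ x / M ≤ δ := by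
      refine ⟨⌈x * ρ x / δ⌉₊ + 1, by omega, ?_⟩
      have h1 : x * ρ x / δ ≤ (⌈x * ρ x / δ⌉₊ : ℝ) := Nat.le_ceil _
      rw [div_le_iff₀ hδ] at h1
      rw [div_le_iff₀ (by positivity)]
      push_cast
      nlinarith
    have hM0 : (0 : ℝ) < M := by exact_mod_cast hM1
    obtain ⟨η, hη⟩ : ∃ η : ℝ, η = x / M := ⟨_, rfl⟩
    have hη0 : 0 < η := by rw [hη]; exact div_pos hx hM0
    have hMη : (M : ℝ) * η = x := by rw [hη]; field_simp
    have hηB : (ρ x - ρ 0) * η ≤ δ := by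
      have h0 : 0 ≤ ρ 0 := hρnn 0 (hx.trans hxL)
      calc (ρ x - ρ 0) * η ≤ ρ x * η := by nlinarith
        _ = x * ρ x / M := by rw [hη]; ring
        _ ≤ δ := hMδ
    -- grid data: breakpoints `t i = i η`, `f i = ρ (t (i - 1))`, increments `c i = f (i+1) - f i`
    obtain ⟨t, ht⟩ : ∃ t : ℕ → ℝ, t = fun i : ℕ => (i : ℝ) * η := ⟨_, rfl⟩
    obtain ⟨f, hf⟩ : ∃ f : ℕ → ℝ, f = fun i : ℕ => ρ ((i : ℝ) * η - η) := ⟨_, rfl⟩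
    obtain ⟨c, hc⟩ : ∃ c : ℕ → ℝ, c = fun i => f (i + 1) - f i := ⟨_, rfl⟩
    have htm : StrictMono t := by
      rw [ht]; exact fun i j hij => mul_lt_mul_of_pos_right (Nat.cast_lt.2 hij) hη0
    have ht0 : ∀ i, 0 ≤ t i := fun i => by rw [ht]; positivity
    have htM : t M = x := by rw [ht]; exact hMη
    have ht_le : ∀ i ≤ M, t i ≤ x := fun i hi => htM ▸ htm.monotone hi
    have htL : ∀ i ≤ M, t i < L := fun i hi => (ht_le i hi).trans_lt hxL
    have hf0 : f 0 = 0 := by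
      rw [hf]
      simp only [Nat.cast_zero, zero_mul, zero_sub]
      exact hρ0 (-η) (by linarith)
    have hf1 : ∀ i : ℕ, f (i + 1) = ρ (t i) := by
      intro i; rw [hf, ht]; push_cast; ring_nf
    have hc1 : ∀ i : ℕ, c (i + 1) = ρ (t (i + 1)) - ρ (t i) := by
      intro i; rw [hc]; simp only [hf1]
    have hc0 : ∀ i ≤ M, 0 ≤ c i := by
      intro i hi
      rcases i with _ | i
      · rw [hc]
        simp only [zero_add, hf1, hf0, sub_zero]
        exact hρnn _ (htL 0 (Nat.zero_le _))
      · rw [hc1, sub_nonneg]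
        exact hmono (htL i (by omega)) (htL (i + 1) hi) (htm.monotone (by omega))
    -- evaluation of the step function `g = Σ_{i<M} c i 𝟙[t i ≤ ·]`
    have hstep : ∀ K ≤ M, ∀ y : ℝ, (∀ i < K, t i ≤ y) → (∀ i, K ≤ i → i < M → y < t i) →
        ∑ i ∈ Finset.range M, (Set.Ici (t i)).indicator (fun _ => c i) y = f K - f 0 := by
      intro K hK y h1 h2
      rw [← Finset.sum_range_add_sum_Ico _ hK]
      have e1 : ∑ i ∈ Finset.range K, (Set.Ici (t i)).indicator (fun _ => c i) y =
          ∑ i ∈ Finset.range K, (f (i + 1) - f i) :=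
        Finset.sum_congr rfl (fun i hi => by
          rw [Set.indicator_of_mem (show y ∈ Set.Ici (t i) from h1 i (Finset.mem_range.1 hi)), hc])
      have e2 : ∑ i ∈ Finset.Ico K M, (Set.Ici (t i)).indicator (fun _ => c i) y = 0 :=
        Finset.sum_eq_zero (fun i hi => by
          rw [Finset.mem_Ico] at hi
          exact Set.indicator_of_notMem (show y ∉ Set.Ici (t i) from not_le.2 (h2 i hi.1 hi.2)) _)
      rw [e1, e2, add_zero, Finset.sum_range_sub]
    -- location of a point of `[0, x)` in the grid
    have hfloor : ∀ y : ℝ, 0 ≤ y → y < x →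
        ⌊y / η⌋₊ < M ∧ t ⌊y / η⌋₊ ≤ y ∧ y < t (⌊y / η⌋₊ + 1) := by
      intro y hy0 hyx
      refine ⟨?_, ?_, ?_⟩
      · rw [Nat.floor_lt (div_nonneg hy0 hη0.le), div_lt_iff₀ hη0, hMη]
        exact hyx
      · rw [ht]
        show (⌊y / η⌋₊ : ℝ) * η ≤ y
        rw [← le_div_iff₀ hη0]
        exact Nat.floor_le (div_nonneg hy0 hη0.le)
      · rw [ht]
        show y < ((⌊y / η⌋₊ + 1 : ℕ) : ℝ) * η
        push_cast
        rw [← div_lt_iff₀ hη0]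
        exact Nat.lt_floor_add_one _
    -- values of `g`: `0` on `(-∞,0)`, `ρ (t k)` on `[t k, t (k+1))`, `ρ (x - η)` at `x`
    have hg_neg : ∀ y < 0,
        ∑ i ∈ Finset.range M, (Set.Ici (t i)).indicator (fun _ => c i) y = 0 := by
      intro y hy
      rw [hstep 0 (Nat.zero_le _) y (fun i hi => absurd hi (Nat.not_lt_zero _))
        (fun i _ _ => hy.trans_le (ht0 i)), sub_self]
    have hg_mid : ∀ y : ℝ, 0 ≤ y → y < x →
        ∑ i ∈ Finset.range M, (Set.Ici (t i)).indicator (fun _ => c i) y = ρ (t ⌊y / η⌋₊) := by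
      intro y hy0 hyx
      obtain ⟨hk, hk1, hk2⟩ := hfloor y hy0 hyx
      rw [hstep (⌊y / η⌋₊ + 1) hk y
        (fun i hi => (htm.monotone (Nat.lt_succ_iff.1 hi)).trans hk1)
        (fun i hi _ => hk2.trans_le (htm.monotone hi)), hf0, sub_zero, hf1]
    have hg_top : ∑ i ∈ Finset.range M, (Set.Ici (t i)).indicator (fun _ => c i) x = f M := by
      rw [hstep M le_rfl x (fun i hi => ht_le i hi.le) (fun i hi hiM => absurd hiM (not_lt.2 hi)),
        hf0, sub_zero]
    -- (A) `g ≤ ρ` on `(-∞, x]`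
    have hA : ∀ y ≤ x, ∑ i ∈ Finset.range M, (Set.Ici (t i)).indicator (fun _ => c i) y ≤ ρ y := by
      intro y hyx
      rcases lt_or_ge y 0 with hy0 | hy0
      · rw [hg_neg y hy0, hρ0 y hy0]
      rcases hyx.lt_or_eq with hyx' | hyx'
      · obtain ⟨hk, hk1, -⟩ := hfloor y hy0 hyx'
        rw [hg_mid y hy0 hyx']
        exact hmono (htL _ hk.le) (hyx.trans_lt hxL) hk1
      · rw [hyx', hg_top, hf]
        have h1 : (M : ℝ) * η - η ≤ x := by rw [hMη]; linarith
        exact hmono (h1.trans_lt hxL) hxL h1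
    -- (B) the `L¹` error, via the step majorant
    -- `u = Σ_{k<M} (ρ(t (k+1)) - ρ(t k)) 𝟙_{[t k, t (k+1))}`
    have hB1 : ∀ y ≤ x, y ≠ x →
        ENNReal.ofReal (ρ y - ∑ i ∈ Finset.range M, (Set.Ici (t i)).indicator (fun _ => c i) y) ≤
          ∑ i ∈ Finset.range M,
            (Set.Ico (t i) (t (i + 1))).indicator (fun _ => ENNReal.ofReal (c (i + 1))) y := by
      intro y hyx hne
      rcases lt_or_ge y 0 with hy0 | hy0
      · rw [hg_neg y hy0, hρ0 y hy0, sub_zero, ENNReal.ofReal_zero]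
        exact zero_le
      · have hyx' : y < x := lt_of_le_of_ne hyx hne
        obtain ⟨hk, hk1, hk2⟩ := hfloor y hy0 hyx'
        have hρy : ρ y ≤ ρ (t (⌊y / η⌋₊ + 1)) :=
          hmono (hyx.trans_lt hxL) (htL _ hk) hk2.le
        calc ENNReal.ofReal (ρ y - ∑ i ∈ Finset.range M,
                (Set.Ici (t i)).indicator (fun _ => c i) y)
            ≤ ENNReal.ofReal (c (⌊y / η⌋₊ + 1)) := by
              apply ENNReal.ofReal_le_ofReal
              rw [hg_mid y hy0 hyx', hc1]
              linarith
          _ = (Set.Ico (t ⌊y / η⌋₊) (t (⌊y / η⌋₊ + 1))).indicator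
                (fun _ => ENNReal.ofReal (c (⌊y / η⌋₊ + 1))) y := by
              rw [Set.indicator_of_mem (show y ∈ Set.Ico _ _ from ⟨hk1, hk2⟩)]
          _ ≤ ∑ i ∈ Finset.range M,
                (Set.Ico (t i) (t (i + 1))).indicator (fun _ => ENNReal.ofReal (c (i + 1))) y :=
              Finset.single_le_sum (f := fun i =>
                (Set.Ico (t i) (t (i + 1))).indicator (fun _ => ENNReal.ofReal (c (i + 1))) y)
                (fun i _ => zero_le) (Finset.mem_range.2 hk)
    have hB2 : ∫⁻ y in Set.Iic x, ENNReal.ofReal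
          (ρ y - ∑ i ∈ Finset.range M, (Set.Ici (t i)).indicator (fun _ => c i) y) ≤
        ∫⁻ y, ∑ i ∈ Finset.range M,
          (Set.Ico (t i) (t (i + 1))).indicator (fun _ => ENNReal.ofReal (c (i + 1))) y := by
      refine (setLIntegral_mono_ae' measurableSet_Iic ?_).trans (setLIntegral_le_lintegral _ _)
      have hne : ∀ᵐ y ∂(volume : Measure ℝ), y ≠ x := by
        rw [ae_iff]
        simp
      filter_upwards [hne] with y hy hyx using hB1 y hyx hy
    have hB3 : ∫⁻ y, ∑ i ∈ Finset.range M,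
          (Set.Ico (t i) (t (i + 1))).indicator (fun _ => ENNReal.ofReal (c (i + 1))) y =
        ENNReal.ofReal ((ρ x - ρ 0) * η) := by
      rw [lintegral_finsetSum _ (fun i _ => measurable_const.indicator measurableSet_Ico)]
      have h1 : ∀ i : ℕ, ∫⁻ y, (Set.Ico (t i) (t (i + 1))).indicator
          (fun _ => ENNReal.ofReal (c (i + 1))) y =
            ENNReal.ofReal (c (i + 1)) * ENNReal.ofReal η := by
        intro i
        rw [lintegral_indicator_const measurableSet_Ico, Real.volume_Ico]
        congr 2
        rw [ht]; push_cast; ring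
      simp only [h1]
      rw [← Finset.sum_mul, ← ENNReal.ofReal_sum_of_nonneg
        (fun i hi => hc0 (i + 1) (Finset.mem_range.1 hi)), ← ENNReal.ofReal_mul
        (Finset.sum_nonneg (fun i hi => hc0 (i + 1) (Finset.mem_range.1 hi)))]
      have h2 : ∑ i ∈ Finset.range M, c (i + 1) = ρ x - ρ 0 := by
        have h3 : ∑ i ∈ Finset.range M, (ρ (t (i + 1)) - ρ (t i)) = ρ (t M) - ρ (t 0) :=
          Finset.sum_range_sub (fun i => ρ (t i)) M
        have h4 : t 0 = 0 := by rw [ht]; simp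
        rw [Finset.sum_congr rfl (fun i _ => hc1 i), h3, htM, h4]
      rw [h2]
    have hB : ∫⁻ y in Set.Iic x, ENNReal.ofReal
          (ρ y - ∑ i ∈ Finset.range M, (Set.Ici (t i)).indicator (fun _ => c i) y) ≤
        ENNReal.ofReal δ :=
      hB2.trans (hB3.le.trans (ENNReal.ofReal_le_ofReal hηB))
    -- drop the zero increments
    obtain ⟨N, e, he, heM, hce, hsum⟩ := stepApprox_filter M t c (fun i hi => hc0 i hi.le)
    refine ⟨N, fun j => t (e j), fun j => c (e j), htm.comp he, fun j => ht0 _,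
      fun j => ht_le _ (heM j).le, hce, ?_, ?_⟩
    · intro y hy
      rw [hsum y]
      exact hA y hy
    · simp only [hsum]
      exact hB

/-! ### The measures of the two strings on `(-∞, x]` -/

/-- **Decomposition of the mass of `S` on `(-∞, x]`**: if `S` has density `ρ` on `(-∞, L)` and
`T` has density `g` with `0 ≤ g ≤ ρ` on `(-∞, x]`, `x < L`, then
`μ_S|(-∞,x] = μ_T|(-∞,x] + (ρ - g) dy|(-∞,x]`. -/
theorem stepApprox_decomp (S T : KreinString) {ρ g : ℝ → ℝ} {L x : ℝ} (hxL : x < L)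
    (hgm : Measurable g)
    (hS : S.massMeasure = (volume.withDensity fun y => ENNReal.ofReal (ρ y)).restrict (Set.Iio L))
    (hT : T.massMeasure = volume.withDensity fun y => ENNReal.ofReal (g y))
    (hg0 : ∀ y, 0 ≤ g y) (hgρ : ∀ y ≤ x, g y ≤ ρ y) :
    S.massMeasure.restrict (Set.Iic x) = T.massMeasure.restrict (Set.Iic x) +
      (volume.restrict (Set.Iic x)).withDensity (fun y => ENNReal.ofReal (ρ y - g y)) := by
  rw [hS, hT, Measure.restrict_restrict measurableSet_Iic,
    Set.inter_eq_left.2 (Set.Iic_subset_Iio.2 hxL), restrict_withDensity measurableSet_Iic,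
    restrict_withDensity measurableSet_Iic, ← withDensity_add_left hgm.ennreal_ofReal]
  refine withDensity_congr_ae ?_
  filter_upwards [ae_restrict_mem measurableSet_Iic] with y hy
  simp only [Pi.add_apply]
  rw [← ENNReal.ofReal_add (hg0 y) (sub_nonneg.2 (hgρ y hy)), add_sub_cancel]

/-- Under the decomposition of `stepApprox_decomp` with `∫_{(-∞,x]} (ρ - g) ≤ δ`, the mass
functions satisfy `|m_T(v) - m_S(v)| ≤ δ` for `v ≤ x`. -/
theorem stepApprox_mass_sub (S T : KreinString) {ρ g : ℝ → ℝ} {x δ : ℝ}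
    (hdec : S.massMeasure.restrict (Set.Iic x) = T.massMeasure.restrict (Set.Iic x) +
      (volume.restrict (Set.Iic x)).withDensity (fun y => ENNReal.ofReal (ρ y - g y)))
    (hlint : ∫⁻ y in Set.Iic x, ENNReal.ofReal (ρ y - g y) ≤ ENNReal.ofReal δ) (hδ : 0 ≤ δ)
    (hxT : x ∈ T.dom) {v : ℝ} (hv : v ≤ x) :
    |T.mass v - S.mass v| ≤ δ := by
  have hD : (volume.restrict (Set.Iic x)).withDensity (fun y => ENNReal.ofReal (ρ y - g y))
      (Set.Iic v) ≤ ENNReal.ofReal δ := by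
    refine (measure_mono (Set.subset_univ _)).trans ?_
    rw [withDensity_apply _ MeasurableSet.univ, Measure.restrict_univ]
    exact hlint
  have h1 : S.massMeasure (Set.Iic v) = T.massMeasure (Set.Iic v) +
      (volume.restrict (Set.Iic x)).withDensity (fun y => ENNReal.ofReal (ρ y - g y))
        (Set.Iic v) := by
    have hS : S.massMeasure (Set.Iic v) = S.massMeasure.restrict (Set.Iic x) (Set.Iic v) := by
      rw [Measure.restrict_apply measurableSet_Iic, Set.Iic_inter_Iic, min_eq_left hv]
    have hT : T.massMeasure (Set.Iic v) = T.massMeasure.restrict (Set.Iic x) (Set.Iic v) := by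
      rw [Measure.restrict_apply measurableSet_Iic, Set.Iic_inter_Iic, min_eq_left hv]
    rw [hS, hT, hdec, Measure.add_apply]
  have hTfin : T.massMeasure (Set.Iic v) ≠ ⊤ :=
    (T.massMeasure_Iic_lt_top v ((ENNReal.ofReal_le_ofReal hv).trans_lt hxT.2)).ne
  have hDfin : (volume.restrict (Set.Iic x)).withDensity (fun y => ENNReal.ofReal (ρ y - g y))
      (Set.Iic v) ≠ ⊤ := ne_top_of_le_ne_top ENNReal.ofReal_ne_top hD
  rw [KreinString.mass_def, KreinString.mass_def, h1, ENNReal.toReal_add hTfin hDfin,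
    ← sub_sub, sub_self, zero_sub, abs_neg, abs_of_nonneg ENNReal.toReal_nonneg]
  exact ENNReal.toReal_le_of_le_ofReal hδ hD

end Summit.RiemannHypothesis.RiemannHypothesis.Theorems.LeeYangTelegraphString

end
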